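import Summits.HubbardSuperconductivity.HubbardSuperconductivity.Theorems.AnisotropyChordTransferFibre3FinXCCover

/-!
# Route `AnisotropyChord` / H0 rotor rung: FIN combined (rows `N₁` + C) certificate at `L = 9` — cell facts, part `p`

Kernel facts `xbcCellAny 9 (49/50) 20 la lb (c, bn) = true` (`decide +kernel`, zero data) for 8 λ-cells of the per-`L` cover
(`…FinXCCover.xbcCheck`; cell design: p3 g5 scratch `xbc_design.py`, mirrors `xb_mirror.py`/`xc_mirror.py`); assembled in `…FinXBCNine`.
Prover seat `hubbard-h0-rotor-p3` g5; helper for piece A = stmt-HubbardSuperconductivity-23918 of rung 19089 (`--supports`, helper class).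
WHAT THIS IS NOT: nothing here proves superconductivity in the Hubbard model (rotor TARGET as worded stays FALSE, g15 verdict); kernel facts for the FIN certificate of two hypotheses (rows `N₁`, C) of ONE conditional reduction.  Tree imports only; no sorry, no new axioms.
-/

set_option linter.dupNamespace false

namespace Summit.HubbardSuperconductivity.HubbardSuperconductivity.Theorems.AnisotropyChord.Transfer.Fibre3

namespace FinXB

set_option maxHeartbeats 4000000 in
/-- kernel fact: cell 132 at `L = 9` (certified, c = (9/20 : ℚ), b = 19/20). [folklore] -/
theorem xbc9_132 : xbcCellAny 9 (49/50 : ℚ) 20 18065310710914649 18516943478687513 ((9/20 : ℚ), (19 : ℕ)) = true := by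
  decide +kernel

set_option maxHeartbeats 4000000 in
/-- kernel fact: cell 133 at `L = 9` (certified, c = (9/20 : ℚ), b = 19/20). [folklore] -/
theorem xbc9_133 : xbcCellAny 9 (49/50 : ℚ) 20 18516943478687513 18979867065654701 ((9/20 : ℚ), (19 : ℕ)) = true := by
  decide +kernel

set_option maxHeartbeats 4000000 in
/-- kernel fact: cell 134 at `L = 9` (certified, c = (9/20 : ℚ), b = 20/20). [folklore] -/
theorem xbc9_134 : xbcCellAny 9 (49/50 : ℚ) 20 18979867065654701 19454363742296065 ((9/20 : ℚ), (20 : ℕ)) = true := by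
  decide +kernel

set_option maxHeartbeats 4000000 in
/-- kernel fact: cell 135 at `L = 9` (certified, c = (9/20 : ℚ), b = 20/20). [folklore] -/
theorem xbc9_135 : xbcCellAny 9 (49/50 : ℚ) 20 19454363742296065 19940722835853465 ((9/20 : ℚ), (20 : ℕ)) = true := by
  decide +kernel

set_option maxHeartbeats 4000000 in
/-- kernel fact: cell 136 at `L = 9` (certified, c = (9/20 : ℚ), b = 20/20). [folklore] -/
theorem xbc9_136 : xbcCellAny 9 (49/50 : ℚ) 20 19940722835853465 20439240906749801 ((9/20 : ℚ), (20 : ℕ)) = true := by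
  decide +kernel

set_option maxHeartbeats 4000000 in
/-- kernel fact: cell 137 at `L = 9` (certified, c = (9/20 : ℚ), b = 21/20). [folklore] -/
theorem xbc9_137 : xbcCellAny 9 (49/50 : ℚ) 20 20439240906749801 20950221929418545 ((9/20 : ℚ), (21 : ℕ)) = true := by
  decide +kernel

set_option maxHeartbeats 4000000 in
/-- kernel fact: cell 138 at `L = 9` (certified, c = (9/20 : ℚ), b = 21/20). [folklore] -/
theorem xbc9_138 : xbcCellAny 9 (49/50 : ℚ) 20 20950221929418545 21473977477654005 ((9/20 : ℚ), (21 : ℕ)) = true := by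
  decide +kernel

set_option maxHeartbeats 4000000 in
/-- kernel fact: cell 139 at `L = 9` (certified, c = (9/20 : ℚ), b = 21/20). [folklore] -/
theorem xbc9_139 : xbcCellAny 9 (49/50 : ℚ) 20 21473977477654005 22010826914595353 ((9/20 : ℚ), (21 : ℕ)) = true := by
  decide +kernel

end FinXB

end Summit.HubbardSuperconductivity.HubbardSuperconductivity.Theorems.AnisotropyChord.Transfer.Fibre3
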